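import Literature.AlgebraicGeometry.ModuliOfAbelianVarieties.SiegelShimuraSetLevelChange
import Literature.AlgebraicGeometry.ModuliOfAbelianVarieties.SiegelShimuraSetHeckeTranslate
import Literature.AlgebraicGeometry.ModuliOfAbelianVarieties.SiegelCanonicalReciprocityLevelChange
import HarnessLib

/-!
# The fibres of the change of level `Sh_{K₁} ↠ Sh_{K₂}` on the Siegel Shimura set are the right `K₂`-orbits
# ([Deligne1971TravauxShimura] 1.8, Déf. 3.1; [Milne2005ShimuraVarieties] §5 (5.1), Thm. 5.17, Thm. 13.6)

Topic `AlgebraicGeometry/ModuliOfAbelianVarieties`; namespace `Literature.AlgebraicGeometry.ModuliOfAbelianVarieties`.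
THEOREMS ONLY (no definition, no named fact, no instance, no `sorry`; net debt 0).  Cell hodgecm-mathlib, #60 road
(A-p05 g7 table v1.9, node **R60-7b′** «fibres of `restrict` = `K₂/K₁`-orbits»; MUMFORD-LINE-SPEC §4 TRANSITIONS + QUOTIENT
BOOKKEEPING; director g6 RULING s86 (2)(b) banked generic leaf).  Sequel of ★ R60-7 `SiegelShimuraSetHeckeTranslate` (right
translates) over ★ R60-13c `SiegelShimuraSetLevelChange` (B-p01: the DATA map `SiegelShimuraSet.restrict`) and ★ R60-25
`SiegelCanonicalReciprocityLevelChange` (A-p05: `ptsSymm_mk_eq_map`).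

THE PRINT.  [Milne2005ShimuraVarieties] Thm. 5.17 p. 60: the `Sh_K(G, X)` form a projective system, `Sh_{K′} → Sh_K` for `K′ ⊂ K`,
and «if `K′` is normal in `K` then `Sh_K = Sh_{K′}/(K/K′)`»; Thm. 13.6 p. 118 (the same system with its `G(𝔸_f)`-action on the
canonical model); [Deligne1971TravauxShimura] 1.8 p. 129 (`_K M_ℂ(G, h) = G(ℚ)∖(X × G(𝔸_f)/K)`, the projective system) and
Déf. 3.1 p. 136 (the `G(𝔸_f)`-action).

WHAT IS HERE, for levels `K₁ ≤ K₂ ≤ GSp_δ(𝔸_f)`: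
* §1 `SiegelShimuraSet.mk_mul_eq_mk_of_mem` (`[J, akK] = [J, aK]`, `k ∈ K`), **`mk_eq_mk_iff_exists_mem`** (`[J, aK₂] = [J′, a′K₂] ↔
  ∃ k ∈ K₂, [J, akK₁] = [J′, a′K₁]`), the same for ★ `restrict` (`restrict_mk_eq_restrict_mk_iff`, `restrict_mk_mul_eq_of_mem`),
  and the point form `restrict_eq_restrict_iff_exists_rightTranslate` (for `K₂ ≤ N(K₁)`: same image ⇔ some right translate
  `T_k`, `k ∈ K₂`, ★ `existsUnique_rightTranslate`, carries one point to the other) — «`Sh_{K₂} = Sh_{K₁}/(K₂/K₁)`».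
* §2 `principalLevelSubgroup_le_normalizer : K_δ(N) ≤ N(K_δ(N′))` for ALL `N, N′` and the principal-tower specialisations.
* §3 on any ★ `SiegelComplexRecordSystem`: `map_surjective_complexPoints` (transitions are onto on `ℂ`-points) and
  `map_ptsSymm_mk_eq_iff` (same image ⇔ the classes differ by a right `K₂`-translate) — the complex-points input of a
  finite-quotient recognition `Mc_{K₂} = Mc_{K₁}/(K₂/K₁)` (★ `Motives.SepQuotientStages`, T3 Squot kit).

## References
* [Deligne1971TravauxShimura] P. Deligne, *Travaux de Shimura*, Sém. Bourbaki 389 (1971): 1.8 p. 129; Déf. 3.1 p. 136; 4.16 p. 150.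
* [Milne2005ShimuraVarieties] J. S. Milne, *Introduction to Shimura varieties* (2005): §5 (5.1) p. 56, Thm. 5.17 p. 60; Thm. 13.6 p. 118.
-/

set_option autoImplicit false

noncomputable section

open Matrix NumberField IsDedekindDomain

namespace Literature.AlgebraicGeometry.ModuliOfAbelianVarieties

variable {g : ℕ}

/-! ### §1. The fibres of `restrict : Sh_{K₁} → Sh_{K₂}` are the right `K₂`-orbits -/

section Fibres

variable {δ : Fin g → ℕ} {K K₁ K₂ : Subgroup (gspFinAdelic δ)}

/-- Right translation by an element OF the level is trivial: `[J, akK] = [J, aK]` for `k ∈ K`.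
[cite: Milne2005ShimuraVarieties, §5 (5.1) p. 56] -/
theorem SiegelShimuraSet.mk_mul_eq_mk_of_mem {k : gspFinAdelic δ} (hk : k ∈ K) (J : C0pm δ) (a : gspFinAdelic δ) :
    SiegelShimuraSet.mk δ K J (a * k) = SiegelShimuraSet.mk δ K J a := by
  rw [SiegelShimuraSet.mk_eq_mk_iff]
  refine ⟨1, by rw [map_one, conjAct_one], ?_⟩
  rw [map_one, one_smul]
  exact QuotientGroup.eq.mpr (by rwa [inv_mul_cancel_left])

/-- **The fibres of `Sh_{K₁} → Sh_{K₂}` are the right `K₂`-orbits** (`K₁ ≤ K₂`): `[J, aK₂] = [J′, a′K₂] ↔ ∃ k ∈ K₂, [J, akK₁] = [J′, a′K₁]`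
— «`Sh_{K₂} = Sh_{K₁}/(K₂/K₁)`» on representatives. [cite: Milne2005ShimuraVarieties, Thm. 5.17 p. 60] [cite: Deligne1971TravauxShimura, 1.8 p. 129] -/
theorem SiegelShimuraSet.mk_eq_mk_iff_exists_mem (hle : K₁ ≤ K₂) (J J' : C0pm δ) (a a' : gspFinAdelic δ) :
    SiegelShimuraSet.mk δ K₂ J a = SiegelShimuraSet.mk δ K₂ J' a' ↔
      ∃ k ∈ K₂, SiegelShimuraSet.mk δ K₁ J (a * k) = SiegelShimuraSet.mk δ K₁ J' a' := by
  constructor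
  · intro h
    rw [SiegelShimuraSet.mk_eq_mk_iff] at h
    obtain ⟨q, hJ, hq⟩ := h
    have hq' : (((gspRationalToFinAdelic δ q : gspFinAdelic δ) * a' : gspFinAdelic δ) : gspFinAdelic δ ⧸ K₂) =
        (a : gspFinAdelic δ ⧸ K₂) := hq
    have hmem : ((gspRationalToFinAdelic δ q : gspFinAdelic δ) * a')⁻¹ * a ∈ K₂ := QuotientGroup.eq.mp hq'
    -- `k := a⁻¹ (q a') ∈ K₂`, so that `a k = q a'`
    refine ⟨a⁻¹ * ((gspRationalToFinAdelic δ q : gspFinAdelic δ) * a'), ?_, ?_⟩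
    · have h' := K₂.inv_mem hmem
      rwa [_root_.mul_inv_rev, inv_inv] at h'
    · rw [mul_inv_cancel_left, ← hJ]
      exact SiegelShimuraSet.mk_conjAct_smul δ K₁ q J' a'
  · rintro ⟨k, hk, h⟩
    rw [← SiegelShimuraSet.mk_mul_eq_mk_of_mem hk J a]
    exact SiegelShimuraSet.mk_eq_mk_of_le δ hle h

/-- **Fibres of ★ `SiegelShimuraSet.restrict`** on representatives: `restrict [J, aK₁] = restrict [J′, a′K₁] ↔ ∃ k ∈ K₂,
[J, akK₁] = [J′, a′K₁]`. [cite: Milne2005ShimuraVarieties, Thm. 5.17 p. 60] -/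
theorem SiegelShimuraSet.restrict_mk_eq_restrict_mk_iff (hle : K₁ ≤ K₂) (J J' : C0pm δ) (a a' : gspFinAdelic δ) :
    SiegelShimuraSet.restrict δ hle (SiegelShimuraSet.mk δ K₁ J a) =
        SiegelShimuraSet.restrict δ hle (SiegelShimuraSet.mk δ K₁ J' a') ↔
      ∃ k ∈ K₂, SiegelShimuraSet.mk δ K₁ J (a * k) = SiegelShimuraSet.mk δ K₁ J' a' := by
  rw [SiegelShimuraSet.restrict_mk, SiegelShimuraSet.restrict_mk, SiegelShimuraSet.mk_eq_mk_iff_exists_mem hle]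

/-- Right `K₂`-translates preserve the fibres of `restrict`: `restrict [J, akK₁] = restrict [J, aK₁]` for `k ∈ K₂`.
[cite: Milne2005ShimuraVarieties, Thm. 5.17 p. 60] -/
theorem SiegelShimuraSet.restrict_mk_mul_eq_of_mem (hle : K₁ ≤ K₂) {k : gspFinAdelic δ} (hk : k ∈ K₂) (J : C0pm δ)
    (a : gspFinAdelic δ) :
    SiegelShimuraSet.restrict δ hle (SiegelShimuraSet.mk δ K₁ J (a * k)) =
      SiegelShimuraSet.restrict δ hle (SiegelShimuraSet.mk δ K₁ J a) := by
  rw [SiegelShimuraSet.restrict_mk, SiegelShimuraSet.restrict_mk, SiegelShimuraSet.mk_mul_eq_mk_of_mem hk]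

/-- **`Sh_{K₂} = Sh_{K₁}/(K₂/K₁)`, point form**: for `K₁ ≤ K₂` with `K₂` normalising `K₁`, two points of `Sh_{K₁}` have the same image
under `restrict` iff a right translate `T_k`, `k ∈ K₂` (★ `SiegelShimuraSet.existsUnique_rightTranslate`) carries one to the other;
the translates by `k ∈ K₁` act trivially (`mk_mul_eq_mk_of_mem`), so the fibres are orbits of the finite group `K₂/K₁`.
[cite: Milne2005ShimuraVarieties, Thm. 5.17 p. 60; Thm. 13.6 p. 118] [cite: Deligne1971TravauxShimura, Déf. 3.1 p. 136] -/
theorem SiegelShimuraSet.restrict_eq_restrict_iff_exists_rightTranslate (hle : K₁ ≤ K₂)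
    (hN : K₂ ≤ Subgroup.normalizer (K₁ : Set (gspFinAdelic δ))) (c c' : SiegelShimuraSet δ K₁) :
    SiegelShimuraSet.restrict δ hle c = SiegelShimuraSet.restrict δ hle c' ↔
      ∃ k ∈ K₂, ∃ T : SiegelShimuraSet δ K₁ → SiegelShimuraSet δ K₁,
        (∀ (J : C0pm δ) (a : gspFinAdelic δ), T (SiegelShimuraSet.mk δ K₁ J a) = SiegelShimuraSet.mk δ K₁ J (a * k)) ∧
          T c = c' := by
  obtain ⟨⟨J, a⟩, rfl⟩ := SiegelShimuraSet.mk_surjective δ K₁ c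
  obtain ⟨⟨J', a'⟩, rfl⟩ := SiegelShimuraSet.mk_surjective δ K₁ c'
  change SiegelShimuraSet.restrict δ hle (SiegelShimuraSet.mk δ K₁ J a) =
      SiegelShimuraSet.restrict δ hle (SiegelShimuraSet.mk δ K₁ J' a') ↔ _
  rw [SiegelShimuraSet.restrict_mk_eq_restrict_mk_iff hle]
  constructor
  · rintro ⟨k, hk, h⟩
    obtain ⟨T, hT, -⟩ := SiegelShimuraSet.existsUnique_rightTranslate (δ := δ) (K := K₁) (hN hk)
    refine ⟨k, hk, T, hT, ?_⟩
    change T (SiegelShimuraSet.mk δ K₁ J a) = SiegelShimuraSet.mk δ K₁ J' a'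
    rw [hT J a]; exact h
  · rintro ⟨k, hk, T, hT, h⟩
    change T (SiegelShimuraSet.mk δ K₁ J a) = SiegelShimuraSet.mk δ K₁ J' a' at h
    exact ⟨k, hk, by rw [← hT J a]; exact h⟩

end Fibres

/-! ### §2. Principal levels normalise each other -/

section Principal

variable (δ : Fin g → ℕ)

/-- **Every principal level normalises every other**: `K_δ(N) ≤ N(K_δ(N′))` (`K_δ(N) ≤ K_δ(1)`, and `K_δ(1)` normalises `K_δ(N′)`
by ★ `principalLevelSubgroup_one_le_normalizer`).  So §1 applies to the principal tower `K_δ(N′) ≤ K_δ(N)`, `N ∣ N′`: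
`Sh_{K_δ(N)} = Sh_{K_δ(N′)}/(K_δ(N)/K_δ(N′))`. [cite: Deligne1971TravauxShimura, 4.16 p. 150] [cite: Milne2005ShimuraVarieties, Thm. 5.17 p. 60] -/
theorem principalLevelSubgroup_le_normalizer (N N' : ℕ) :
    principalLevelSubgroup δ N ≤ Subgroup.normalizer (principalLevelSubgroup δ N' : Set (gspFinAdelic δ)) :=
  (principalLevelSubgroup_anti δ (one_dvd N)).trans (principalLevelSubgroup_one_le_normalizer δ N')

variable {δ}

/-- Principal-level form of §1: for `N ∣ N′`, `[J, aK_δ(N)] = [J′, a′K_δ(N)] ↔ ∃ k ∈ K_δ(N), [J, akK_δ(N′)] = [J′, a′K_δ(N′)]`.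
[cite: Milne2005ShimuraVarieties, Thm. 5.17 p. 60] -/
theorem SiegelShimuraSet.mk_eq_mk_iff_exists_mem_principal {N N' : ℕ} (h : N ∣ N') (J J' : C0pm δ)
    (a a' : gspFinAdelic δ) :
    SiegelShimuraSet.mk δ (principalLevelSubgroup δ N) J a = SiegelShimuraSet.mk δ (principalLevelSubgroup δ N) J' a' ↔
      ∃ k ∈ principalLevelSubgroup δ N,
        SiegelShimuraSet.mk δ (principalLevelSubgroup δ N') J (a * k) =
          SiegelShimuraSet.mk δ (principalLevelSubgroup δ N') J' a' :=
  SiegelShimuraSet.mk_eq_mk_iff_exists_mem (principalLevelSubgroup_anti δ h) J J' a a'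

/-- Point form on the principal tower: the fibres of `restrict : Sh_{K_δ(N′)} → Sh_{K_δ(N)}` (`N ∣ N′`) are the orbits of the right
`K_δ(N)`-translates. [cite: Milne2005ShimuraVarieties, Thm. 5.17 p. 60] -/
theorem SiegelShimuraSet.restrict_eq_restrict_iff_exists_rightTranslate_principal {N N' : ℕ} (h : N ∣ N')
    (c c' : SiegelShimuraSet δ (principalLevelSubgroup δ N')) :
    SiegelShimuraSet.restrict δ (principalLevelSubgroup_anti δ h) c =
        SiegelShimuraSet.restrict δ (principalLevelSubgroup_anti δ h) c' ↔
      ∃ k ∈ principalLevelSubgroup δ N,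
        ∃ T : SiegelShimuraSet δ (principalLevelSubgroup δ N') → SiegelShimuraSet δ (principalLevelSubgroup δ N'),
          (∀ (J : C0pm δ) (a : gspFinAdelic δ),
              T (SiegelShimuraSet.mk δ (principalLevelSubgroup δ N') J a) =
                SiegelShimuraSet.mk δ (principalLevelSubgroup δ N') J (a * k)) ∧ T c = c' :=
  SiegelShimuraSet.restrict_eq_restrict_iff_exists_rightTranslate (principalLevelSubgroup_anti δ h)
    (principalLevelSubgroup_le_normalizer δ N N') c c'

end Principal

/-! ### §3. On a Siegel complex record system: transitions are surjective on `ℂ`-points with fibres the `K₂`-orbits -/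

section RecordSystem

variable {δ : Fin g → ℕ}

/-- **The transition morphisms of a Siegel complex record system are surjective on complex points** (`pts` is a bijection at
both levels and `restrict` is onto, ★ `SiegelShimuraSet.restrict_surjective`, ★ `SiegelComplexRecordSystem.pts_map_eq_restrict`).
[cite: Milne2005ShimuraVarieties, Thm. 5.17 p. 60] -/
theorem SiegelComplexRecordSystem.map_surjective_complexPoints (Sg : SiegelComplexRecordSystem g δ) {K₁ K₂ : SiegelLevel δ}
    (f : K₁ ⟶ K₂) :
    Function.Surjective (Motives.AlgPoints.map (Sg.Mc.map f) :
      Motives.ComplexPoints (Sg.Mc.obj K₁) → Motives.ComplexPoints (Sg.Mc.obj K₂)) := by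
  intro Q
  obtain ⟨c, hc⟩ := SiegelShimuraSet.restrict_surjective δ (SiegelLevel.le_of_hom f) (Sg.pts K₂ Q)
  refine ⟨(Sg.pts K₁).symm c, (Sg.pts K₂).injective ?_⟩
  rw [Sg.pts_map_eq_restrict K₁ K₂ f c, hc]

/-- **The fibres of a transition morphism on complex points are the right `K₂`-orbits**: for `f : K₁ ⟶ K₂`, the points
`(Sg.pts K₁)⁻¹[J, aK₁]`, `(Sg.pts K₁)⁻¹[J′, a′K₁]` have the same image under `Sg.Mc.map f` iff `[J, akK₁] = [J′, a′K₁]` for some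
`k ∈ K₂` — the complex-points half of «`Mc_{K₂} = Mc_{K₁}/(K₂/K₁)`» (the orbit condition a finite-quotient recognition needs;
★ `SiegelRationalModel.ptsSymm_mk_eq_map` for the images). [cite: Milne2005ShimuraVarieties, Thm. 5.17 p. 60; Thm. 13.6 p. 118]
[cite: Deligne1971TravauxShimura, Déf. 3.1 p. 136] -/
theorem SiegelComplexRecordSystem.map_ptsSymm_mk_eq_iff (Sg : SiegelComplexRecordSystem g δ) {K₁ K₂ : SiegelLevel δ}
    (f : K₁ ⟶ K₂) (J J' : C0pm δ) (a a' : gspFinAdelic δ) :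
    Motives.AlgPoints.map (Sg.Mc.map f) ((Sg.pts K₁).symm (SiegelShimuraSet.mk δ K₁.1 J a)) =
        Motives.AlgPoints.map (Sg.Mc.map f) ((Sg.pts K₁).symm (SiegelShimuraSet.mk δ K₁.1 J' a')) ↔
      ∃ k ∈ (K₂.1 : Subgroup (gspFinAdelic δ)),
        SiegelShimuraSet.mk δ K₁.1 J (a * k) = SiegelShimuraSet.mk δ K₁.1 J' a' := by
  rw [← SiegelRationalModel.ptsSymm_mk_eq_map Sg f J a, ← SiegelRationalModel.ptsSymm_mk_eq_map Sg f J' a',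
    (Sg.pts K₂).symm.injective.eq_iff]
  exact SiegelShimuraSet.mk_eq_mk_iff_exists_mem (SiegelLevel.le_of_hom f) J J' a a'

end RecordSystem

end Literature.AlgebraicGeometry.ModuliOfAbelianVarieties

end
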